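import Mathlib
import Literature.RepresentationTheory.FiniteGroups.IrreducibleCharacters
import Literature.RepresentationTheory.FiniteGroups.BrauerTheorem

/-!
# The abelian axis family, explicit coordinates (siege k6: elementary route)

Route `LevelGradedCohnUmans`, crux `GradedDesignFamily` (stmt-MatrixMultiplication-7610), stub
`abelianAxisFamily_of_le`.  An explicit, coordinate-level proof that the two-piece axis family of
Cohn–Kleinberg–Szegedy–Umans (2005, Prop. 5.2) in the abelian group `(ℤ/16)³` is a graded
simultaneous family at every exponent `2 + ε`, `ε ≥ 41/50`:

* host `G = Multiplicative (Fin 3 → ZMod 16)`, test space `J = ⊤` (trivially bi-invariant);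
* pieces (`t = 2`): `X a = e_a-axis`, `Y a = e_{a+1}-axis`, `Z a = e_{a+2}-axis` (punctured
  coordinate axes `{s • e_c : s ≠ 0}`), each piece of volume `15³`;
* simultaneous separation by the delta function at the target `x₀⁻¹ z₀`, which is correct by the
  SIMULTANEOUS TRIPLE PRODUCT PROPERTY, proved here by reading the three coordinates of
  `-x + y - y' + z = -x₀ + z₀` (`axis_coord_stpp`, valid in any additive group);
* budget: every irreducible character of an abelian group has degree `1` and the irreducible
  characters are linearly independent functions on `G`, so
  `Σ_{Irr G} χ(1)^{2+ε} = #Irr G ≤ dim ℂ^G = |G| = 4096`;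
* numerics: `4096 < 2 · (15³)^{(2+ε)/3}` because `(2+ε)/3 ≥ 47/50` and
  `2048⁵⁰ = 2⁵⁵⁰ < 15¹⁴¹ = (15³)⁴⁷`.

(`n = 16` minimises the threshold `(3 log n - log 2)/log (n-1) - 2 ≈ 0.8155` of this family.)
[cite: CohnKleinbergSzegedyUmans2005, §5 Def. 5.1, Prop. 5.2 (arXiv numbering Def. 27, Prop. 28)]
-/

noncomputable section

-- declarations of this sub-problem live in `Summit.MatrixMultiplication.MatrixMultiplication.…`,
-- whose two leading components coincide by the tree layout (summit = sub-problem), hence: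
set_option linter.dupNamespace false

open scoped BigOperators
open Literature.RepresentationTheory.FiniteGroups

namespace Summit.MatrixMultiplication.MatrixMultiplication.Theorems.GradedDesignFamily.AxisExplicit

/-- **Coordinate form of the STPP of the axis family.**  In any additive group `R`, for nonzero
scalars, the identity `-s•e_a + u•e_{a+1} - u'•e_{b+1} + v•e_{b+2} = -s₀•e_i + v₀•e_{i+2}`
in `R³` (indices `a b i ∈ {0,1} ⊂ Fin 3`, standard basis `e_0, e_1, e_2`)
forces `a = b = i`, `s = s₀`, `u = u'`, `v = v₀`: read it coordinatewise (in each of the six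
off-diagonal cases some coordinate carries exactly one of the six nonzero scalars).
[cite: CohnKleinbergSzegedyUmans2005, §5 Prop. 5.2] -/
theorem axis_coord_stpp {R : Type*} [AddCommGroup R] (i a b : Fin 2) {s u u' v s₀ v₀ : R}
    (hs : s ≠ 0) (hu : u ≠ 0) (hu' : u' ≠ 0) (hv : v ≠ 0) (hs₀ : s₀ ≠ 0) (hv₀ : v₀ ≠ 0)
    (hE : -(Pi.single (Fin.castSucc a) s : Fin 3 → R) + Pi.single (Fin.succ a) u
        + -Pi.single (Fin.succ b) u' + Pi.single (Fin.succ b + 1) v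
      = -Pi.single (Fin.castSucc i) s₀ + Pi.single (Fin.succ i + 1) v₀) :
    a = i ∧ b = i ∧ s = s₀ ∧ u = u' ∧ v = v₀ := by
  have h0 := congrFun hE 0
  have h1 := congrFun hE 1
  have h2 := congrFun hE 2
  fin_cases i <;> fin_cases a <;> fin_cases b <;> simp at h0 h1 h2 ⊢ <;> simp_all [add_neg_eq_zero]

/-- **STPP families through the full test space.**  In a finite abelian group read through
`J = ⊤ = ℂ^G` (bi-invariant for trivial reasons), a family of triples with the simultaneous triple
product property — stated as: a mixed quadruple product `x⁻¹ y y'⁻¹ z` hits a target `x₀⁻¹ z₀` of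
piece `i` only on the diagonal — is simultaneously `J`-separated by delta functions, and it beats
the graded budget at exponent `2 + ε` as soon as `|G| < Σ_i V_i^{(2+ε)/3}`, because that budget is
`#Irr(G) ≤ |G|` (degrees `1`, linear independence of irreducible characters).
[cite: CohnKleinbergSzegedyUmans2005, §5 Def. 5.1] -/
theorem family_top_of_stpp {G : Type} [CommGroup G] [Fintype G] {t : ℕ}
    (X Y Z : Fin t → Finset G)
    (hstpp : ∀ i a b : Fin t, ∀ x₀ ∈ X i, ∀ z₀ ∈ Z i, ∀ x ∈ X a, ∀ y ∈ Y a, ∀ y' ∈ Y b,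
      ∀ z ∈ Z b, x⁻¹ * y * y'⁻¹ * z = x₀⁻¹ * z₀ → a = i ∧ b = i ∧ x = x₀ ∧ y = y' ∧ z = z₀)
    (ε : ℝ)
    (hlt : (Fintype.card G : ℝ) <
      ∑ i, (((X i).card * (Y i).card * (Z i).card : ℕ) : ℝ) ^ ((2 + ε) / 3)) :
    ∃ (G : Type) (_ : Group G) (_ : Fintype G)
      (J : Submodule ℂ (G → ℂ)) (t : ℕ) (X Y Z : Fin t → Finset G),
      (∀ f ∈ J, ∀ a b : G, (fun g : G => f (a * g * b)) ∈ J) ∧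
      (∀ i : Fin t, ∀ x₀ ∈ X i, ∀ z₀ ∈ Z i, ∃ f ∈ J, ∀ a b : Fin t, ∀ x ∈ X a, ∀ y ∈ Y a,
        ∀ y' ∈ Y b, ∀ z ∈ Z b,
          ((a = i ∧ b = i ∧ x = x₀ ∧ y = y' ∧ z = z₀) → f (x⁻¹ * y * y'⁻¹ * z) = 1) ∧
          (¬ (a = i ∧ b = i ∧ x = x₀ ∧ y = y' ∧ z = z₀) → f (x⁻¹ * y * y'⁻¹ * z) = 0)) ∧
      (∑ᶠ χ ∈ irrChars G ∩ (J : Set (G → ℂ)), (χ 1).re ^ (2 + ε)) <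
        ∑ i, (((X i).card * (Y i).card * (Z i).card : ℕ) : ℝ) ^ ((2 + ε) / 3) := by
  classical
  refine ⟨G, inferInstance, inferInstance, ⊤, t, X, Y, Z, fun _ _ _ _ => Submodule.mem_top,
    fun i x₀ hx₀ z₀ hz₀ => ⟨fun g => if g = x₀⁻¹ * z₀ then 1 else 0, Submodule.mem_top,
      fun a b x hx y hy y' hy' z hz => ⟨?_, fun hne => if_neg fun hq =>
        hne (hstpp i a b x₀ hx₀ z₀ hz₀ x hx y hy y' hy' z hz hq)⟩⟩, ?_⟩
  · rintro ⟨-, -, rfl, rfl, rfl⟩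
    simp
  · -- budget `= #Irr(G) ≤ dim ℂ^G = |G|`
    refine lt_of_le_of_lt ?_ hlt
    haveI : IsMulCommutative G := ⟨⟨mul_comm⟩⟩
    have hfin : (irrChars G).Finite := irrChars_finite_holds G
    rw [Submodule.top_coe, Set.inter_univ, finsum_mem_eq_finite_toFinset_sum _ hfin,
      Finset.sum_congr rfl fun χ hχ => by
        rw [(hfin.mem_toFinset.mp hχ).map_one, Complex.one_re, Real.one_rpow],
      Finset.sum_const, nsmul_eq_mul, mul_one]
    haveI : Fintype (irrChars G) := hfin.fintype
    have hli := (linearIndependent_irrChars (G := G)).fintype_card_le_finrank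
    rw [Module.finrank_fintype_fun_eq_card] at hli
    rw [hfin.card_toFinset]
    exact_mod_cast hli

/-- **The abelian axis family at every `ε ≥ 41/50`** (explicit instance `n = 16`): in
`G = (ℤ/16)³` (written multiplicatively) with `J = ⊤`, the two pieces
`X a = {s•e_a}`, `Y a = {u•e_{a+1}}`, `Z a = {v•e_{a+2}}` (`a ∈ {0,1}`, nonzero scalars) form a
bi-invariant, simultaneously `J`-separated family with
`Σ_{Irr G} χ(1)^{2+ε} ≤ 4096 < 2·3375^{(2+ε)/3} = Σ_a (|X a||Y a||Z a|)^{(2+ε)/3}`.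
[cite: CohnKleinbergSzegedyUmans2005, §5 Prop. 5.2] -/
theorem abelianAxisFamily_of_le (ε : ℝ) (hε : (41 : ℝ) / 50 ≤ ε) :
    ∃ (G : Type) (_ : Group G) (_ : Fintype G)
      (J : Submodule ℂ (G → ℂ)) (t : ℕ) (X Y Z : Fin t → Finset G),
      (∀ f ∈ J, ∀ a b : G, (fun g : G => f (a * g * b)) ∈ J) ∧
      (∀ i : Fin t, ∀ x₀ ∈ X i, ∀ z₀ ∈ Z i, ∃ f ∈ J, ∀ a b : Fin t, ∀ x ∈ X a, ∀ y ∈ Y a,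
        ∀ y' ∈ Y b, ∀ z ∈ Z b,
          ((a = i ∧ b = i ∧ x = x₀ ∧ y = y' ∧ z = z₀) → f (x⁻¹ * y * y'⁻¹ * z) = 1) ∧
          (¬ (a = i ∧ b = i ∧ x = x₀ ∧ y = y' ∧ z = z₀) → f (x⁻¹ * y * y'⁻¹ * z) = 0)) ∧
      (∑ᶠ χ ∈ irrChars G ∩ (J : Set (G → ℂ)), (χ 1).re ^ (2 + ε)) <
        ∑ i, (((X i).card * (Y i).card * (Z i).card : ℕ) : ℝ) ^ ((2 + ε) / 3) := by
  classical
  -- the punctured coordinate axes of `(ℤ/16)³`, as subsets of the multiplicative copy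
  refine family_top_of_stpp (G := Multiplicative (Fin 3 → ZMod 16)) (t := 2)
    (fun a => (Finset.univ.filter fun s : ZMod 16 => s ≠ 0).image fun s =>
      Multiplicative.ofAdd (Pi.single (Fin.castSucc a) s))
    (fun a => (Finset.univ.filter fun s : ZMod 16 => s ≠ 0).image fun s =>
      Multiplicative.ofAdd (Pi.single (Fin.succ a) s))
    (fun a => (Finset.univ.filter fun s : ZMod 16 => s ≠ 0).image fun s =>
      Multiplicative.ofAdd (Pi.single (Fin.succ a + 1) s))
    ?_ ε ?_
  · -- simultaneous triple product property, from the coordinate lemma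
    intro i a b x₀ hx₀ z₀ hz₀ x hx y hy y' hy' z hz hq
    simp only [Finset.mem_image, Finset.mem_filter, Finset.mem_univ, true_and] at hx₀ hz₀ hx
    simp only [Finset.mem_image, Finset.mem_filter, Finset.mem_univ, true_and] at hy hy' hz
    obtain ⟨s₀, hs₀, rfl⟩ := hx₀
    obtain ⟨v₀, hv₀, rfl⟩ := hz₀
    obtain ⟨s, hs, rfl⟩ := hx
    obtain ⟨u, hu, rfl⟩ := hy
    obtain ⟨u', hu', rfl⟩ := hy'
    obtain ⟨v, hv, rfl⟩ := hz
    have hE := congrArg Multiplicative.toAdd hq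
    simp only [toAdd_mul, toAdd_inv, toAdd_ofAdd] at hE
    obtain ⟨rfl, rfl, rfl, rfl, rfl⟩ := axis_coord_stpp i a b hs hu hu' hv hs₀ hv₀ hE
    exact ⟨rfl, rfl, rfl, rfl, rfl⟩
  · -- `|G| = 4096 < 2 · 3375^{(2+ε)/3}`
    have hcard : ∀ c : Fin 3, ((Finset.univ.filter fun s : ZMod 16 => s ≠ 0).image fun s =>
        Multiplicative.ofAdd (Pi.single c s : Fin 3 → ZMod 16)).card = 15 := fun c => by
      have hinj : Function.Injective fun s : ZMod 16 =>
          Multiplicative.ofAdd (Pi.single c s : Fin 3 → ZMod 16) :=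
        Multiplicative.ofAdd.injective.comp
          (Pi.single_injective (M := fun _ : Fin 3 => ZMod 16) c)
      rw [Finset.card_image_of_injective _ hinj, Finset.filter_ne' Finset.univ (0 : ZMod 16),
        Finset.card_erase_of_mem (Finset.mem_univ _), Finset.card_univ, ZMod.card]
    simp only [hcard, Finset.sum_const, Finset.card_univ, Fintype.card_fin, nsmul_eq_mul,
      Fintype.card_multiplicative, Fintype.card_fun, ZMod.card]
    push_cast
    -- goal: `16 ^ 3 < 2 * (15 * 15 * 15) ^ ((2 + ε) / 3)`; first `47/50 ≤ (2 + ε)/3`, then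
    -- `2048 < 3375 ^ (47/50)` since `2048 ^ 50 < 3375 ^ 47` (exact integers)
    have hmono : (3375 : ℝ) ^ ((47 : ℝ) / 50) ≤ (3375 : ℝ) ^ ((2 + ε) / 3) :=
      Real.rpow_le_rpow_of_exponent_le (by norm_num) (by linarith)
    have hkey : (2048 : ℝ) < (3375 : ℝ) ^ ((47 : ℝ) / 50) := by
      refine lt_of_pow_lt_pow_left₀ 50 (Real.rpow_nonneg (by norm_num) _) ?_
      rw [← Real.rpow_natCast ((3375 : ℝ) ^ ((47 : ℝ) / 50)), ← Real.rpow_mul (by norm_num)]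
      norm_num
    linarith

end Summit.MatrixMultiplication.MatrixMultiplication.Theorems.GradedDesignFamily.AxisExplicit

end
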